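import Mathlib
import Literature.Computability.AlgebraicComplexity.StandardFamilies
import Summits.ValiantsHypothesis.ValiantsHypothesis.Theorems.ChowBorderDepth3LocalFanInTwoFlattening

/-!
# The middle catalecticant of the permanent has an identity minor of size `C(n,k)²`
# (helper for `ChowBorderDepth3.LocalFanInTwo`)

Support file for item `stmt-ValiantsHypothesis-5938` (`LocalFanInTwo`) of route
`ValiantsHypothesis/ChowBorderDepth3`.  For `k ≤ n` we exhibit `N = C(n,k)²` words `α i` of
length `k` and `N` words `β j` of length `n - k` in the variables `x_{ab}` of the generic `n × n`
matrix such that the matrix of full iterated derivatives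
`(∂_{α i ++ β j} per_n)_{i,j}` is the IDENTITY: index both by pairs `(S, T)` of `k`-subsets of
rows and columns, fix a permutation `π_{S,T}` carrying `T` onto `S`, and take
`α (S,T) = ((π j, j))_{j ∈ T}`, `β (S,T) = ((π j, j))_{j ∉ T}`; then `∂_{α ++ β} per_n` is the
coefficient of the corresponding degree-`n` monomial in `per_n = Σ_σ Π_j x_{σ j, j}`, which is `1`
on the diagonal (the monomial of `π_{S,T}`) and `0` off it (a column index repeats, or a row index
repeats).  This is the classical computation "the space of order-`k` partials of `per_n` is spanned
by the `C(n,k)²` permanental minors" (Nisan–Wigderson 1996/97, §3; Landsberg 2017, §6.2), in the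
form consumed by `card_le_card_of_border_powers`.

Main result: `exists_perPoly_flattening`.

References: N. Nisan, A. Wigderson, *Lower bounds on arithmetic circuits via partial
derivatives*, Comput. Complexity 6 (1996/97), §3; J. M. Landsberg, *Geometry and complexity
theory*, CUP 2017, §6.2.
-/

noncomputable section

-- `Summit.ValiantsHypothesis.ValiantsHypothesis.…` is the tree's mandated single-conjunct layout
-- (Sub = Summit), so the duplicated namespace component is intended.
set_option linter.dupNamespace false

namespace Summit.ValiantsHypothesis.ValiantsHypothesis.Theorems.ChowBorderDepth3LocalFanInTwo

open MvPolynomial Literature.Computability.AlgebraicComplexity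

variable {n : ℕ}

/-- `per_n = Σ_π x^{ρ(π)}` with `ρ(π) = Σ_j e_{(π j, j)}` the exponent of the monomial of `π`.
[folklore] -/
theorem perPoly_eq_sum_monomial (n : ℕ) :
    perPoly (Fin n) ℂ = ∑ π : Equiv.Perm (Fin n),
      monomial (∑ i, Finsupp.single (π i, i) 1) (1 : ℂ) := by
  unfold perPoly Matrix.permanent
  refine Finset.sum_congr rfl fun π _ => ?_
  rw [monomial_sum_one]
  rfl

/-- The exponent of `x_{ab}` in the monomial of `π` is `[π b = a]`. [folklore] -/
theorem rho_apply (π : Equiv.Perm (Fin n)) (a b : Fin n) :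
    (∑ i, Finsupp.single (π i, i) (1 : ℕ)) (a, b) = if π b = a then 1 else 0 := by
  rw [Finsupp.finsetSum_apply, Finset.sum_eq_single b]
  · simp only [Finsupp.single_apply, Prod.mk.injEq, and_true]
  · intro i _ hib
    rw [Finsupp.single_apply, if_neg]
    exact fun h => hib (Prod.mk.injEq _ _ _ _ ▸ h).2
  · intro h; exact absurd (Finset.mem_univ b) h

/-- Distinct permutations have distinct monomials. [folklore] -/
theorem rho_injective : Function.Injective
    (fun π : Equiv.Perm (Fin n) => ∑ i, Finsupp.single (π i, i) (1 : ℕ)) := by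
  intro π τ h
  refine Equiv.ext fun b => ?_
  have key := congrArg (fun d : Fin n × Fin n →₀ ℕ => d (τ b, b)) h
  simp only [rho_apply, if_true] at key
  by_contra hne
  rw [if_neg hne] at key
  exact zero_ne_one key

/-- Coefficients of the generic permanent: `coeff d per_n = #{π : ρ(π) = d}`. [folklore] -/
theorem coeff_perPoly (d : Fin n × Fin n →₀ ℕ) :
    coeff d (perPoly (Fin n) ℂ) = ∑ π : Equiv.Perm (Fin n),
      if (∑ i, Finsupp.single (π i, i) (1 : ℕ)) = d then (1 : ℂ) else 0 := by
  rw [perPoly_eq_sum_monomial, coeff_sum]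
  simp only [coeff_monomial]

/-- The coefficient of the monomial of `π` in `per_n` is `1`. [folklore] -/
theorem coeff_perPoly_rho (π : Equiv.Perm (Fin n)) :
    coeff (∑ i, Finsupp.single (π i, i) (1 : ℕ)) (perPoly (Fin n) ℂ) = 1 := by
  rw [coeff_perPoly, Finset.sum_eq_single π]
  · rw [if_pos rfl]
  · intro τ _ hτ
    rw [if_neg]
    exact fun h => hτ (rho_injective h)
  · intro h; exact absurd (Finset.mem_univ π) h

/-- A monomial that is not a permutation monomial does not occur in `per_n`. [folklore] -/
theorem coeff_perPoly_eq_zero {d : Fin n × Fin n →₀ ℕ}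
    (h : ∀ π : Equiv.Perm (Fin n), (∑ i, Finsupp.single (π i, i) (1 : ℕ)) ≠ d) :
    coeff d (perPoly (Fin n) ℂ) = 0 := by
  rw [coeff_perPoly]
  exact Finset.sum_eq_zero fun π _ => if_neg (h π)

/-- Column sums of a permutation monomial are all `1`. [folklore] -/
theorem mapDomain_snd_rho (π : Equiv.Perm (Fin n)) (j : Fin n) :
    Finsupp.mapDomain Prod.snd (∑ i, Finsupp.single (π i, i) (1 : ℕ)) j = 1 := by
  rw [Finsupp.mapDomain_finsetSum]
  simp only [Finsupp.mapDomain_single, Finsupp.finsetSum_apply, Finsupp.single_apply,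
    Finset.sum_ite_eq', Finset.mem_univ, if_true]

/-- Row sums of a permutation monomial are all `1`. [folklore] -/
theorem mapDomain_fst_rho (π : Equiv.Perm (Fin n)) (a : Fin n) :
    Finsupp.mapDomain Prod.fst (∑ i, Finsupp.single (π i, i) (1 : ℕ)) a = 1 := by
  rw [Finsupp.mapDomain_finsetSum]
  simp only [Finsupp.mapDomain_single, Finsupp.finsetSum_apply, Finsupp.single_apply]
  rw [Finset.sum_eq_single (π.symm a)]
  · simp
  · intro i _ hi
    rw [if_neg]
    intro h
    apply hi
    rw [← h, Equiv.symm_apply_apply]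
  · intro h; exact absurd (Finset.mem_univ _) h

/-- Column sums of the exponent `Σ_{j ∈ A} e_{(π j, j)}`: the indicator of `A`. [folklore] -/
theorem mapDomain_snd_sum_single (π : Fin n → Fin n) (A : Finset (Fin n)) (j₀ : Fin n) :
    Finsupp.mapDomain Prod.snd (∑ j ∈ A, Finsupp.single (π j, j) (1 : ℕ)) j₀ =
      if j₀ ∈ A then 1 else 0 := by
  rw [Finsupp.mapDomain_finsetSum]
  simp only [Finsupp.mapDomain_single, Finsupp.finsetSum_apply, Finsupp.single_apply,
    Finset.sum_ite_eq']

/-- Row sum `a₀` of the exponent `Σ_{j ∈ A} e_{(π j, j)}` is at least `1` when `π⁻¹ a₀ ∈ A`.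
[folklore] -/
theorem one_le_mapDomain_fst_sum_single (π : Equiv.Perm (Fin n)) (A : Finset (Fin n)) (a₀ : Fin n)
    (h : π.symm a₀ ∈ A) :
    1 ≤ Finsupp.mapDomain Prod.fst (∑ j ∈ A, Finsupp.single (π j, j) (1 : ℕ)) a₀ := by
  rw [Finsupp.mapDomain_finsetSum]
  simp only [Finsupp.mapDomain_single, Finsupp.finsetSum_apply, Finsupp.single_apply]
  calc (1 : ℕ) = if π (π.symm a₀) = a₀ then 1 else 0 := by simp
    _ ≤ ∑ j ∈ A, if π j = a₀ then 1 else 0 :=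
        Finset.single_le_sum (f := fun j => if π j = a₀ then 1 else 0) (fun _ _ => Nat.zero_le _) h

/-- Two finite sets of the same size admit a permutation of the ambient `Fin n` carrying one
onto the other: `π j ∈ S ↔ j ∈ T`. [folklore] -/
theorem exists_perm_mem_iff (S T : Finset (Fin n)) (h : S.card = T.card) :
    ∃ π : Equiv.Perm (Fin n), ∀ j, π j ∈ S ↔ j ∈ T := by
  classical
  have h1 : Fintype.card {x // x ∈ T} = Fintype.card {x // x ∈ S} := by simp [h]
  have h2 : Fintype.card {x // x ∉ T} = Fintype.card {x // x ∉ S} := by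
    rw [Fintype.card_subtype_compl, Fintype.card_subtype_compl, h1]
  let e : {x // x ∈ T} ≃ {x // x ∈ S} := Fintype.equivOfCardEq h1
  let f : {x // x ∉ T} ≃ {x // x ∉ S} := Fintype.equivOfCardEq h2
  refine ⟨Equiv.subtypeCongr e f, fun j => ?_⟩
  by_cases hj : j ∈ T
  · have hval : (Equiv.subtypeCongr e f) j = e ⟨j, hj⟩ := by
      simp [Equiv.subtypeCongr, Equiv.sumCompl_symm_apply_of_pos hj]
    rw [hval]
    exact ⟨fun _ => hj, fun _ => (e ⟨j, hj⟩).2⟩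
  · have hval : (Equiv.subtypeCongr e f) j = f ⟨j, hj⟩ := by
      simp [Equiv.subtypeCongr, Equiv.sumCompl_symm_apply_of_neg hj]
    rw [hval]
    exact ⟨fun h' => absurd h' (f ⟨j, hj⟩).2, fun h' => absurd h' hj⟩

/-- **An identity minor of size `C(n,k)²` in the middle catalecticant of the permanent.**  For
`k ≤ n` there are `N = C(n,k)²` words `α i` of length `k` and `β j` of length `n - k` in the
variables `x_{ab}` with `(∂_{α i ++ β j} per_n)_{i,j}` of non-zero determinant (indeed the
identity matrix): the order-`k` partials of `per_n` span the `C(n,k)²` permanental minors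
(Nisan–Wigderson 1996/97, §3; Landsberg 2017, §6.2). [cite: LandsbergGCT2017, §6.2] -/
theorem exists_perPoly_flattening (n k : ℕ) (hk : k ≤ n) :
    ∃ (N : ℕ) (α β : Fin N → List (Fin n × Fin n)), N = (n.choose k) ^ 2 ∧
      (∀ i j, (α i).length + (β j).length = n) ∧
      (Matrix.of fun i j => coeff 0 ((α i ++ β j).foldr (fun v g => pderiv v g)
        (perPoly (Fin n) ℂ))).det ≠ 0 := by
  classical
  -- index set: pairs `(S, T)` of `k`-subsets of `Fin n`
  set P : Finset (Finset (Fin n)) := Finset.powersetCard k Finset.univ with hP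
  have hmemP : ∀ {S : Finset (Fin n)}, S ∈ P → S.card = k := fun h =>
    (Finset.mem_powersetCard.1 h).2
  -- a permutation carrying `T` onto `S` for each pair
  have hperm : ∀ p : P × P, ∃ π : Equiv.Perm (Fin n),
      ∀ j, π j ∈ (p.1 : Finset (Fin n)) ↔ j ∈ (p.2 : Finset (Fin n)) := by
    rintro ⟨⟨S, hS⟩, ⟨T, hT⟩⟩
    exact exists_perm_mem_iff S T ((hmemP hS).trans (hmemP hT).symm)
  choose π hπ using hperm
  -- the words
  let α : P × P → List (Fin n × Fin n) := fun p =>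
    (p.2 : Finset (Fin n)).toList.map fun j => (π p j, j)
  let β : P × P → List (Fin n × Fin n) := fun p =>
    ((p.2 : Finset (Fin n))ᶜ).toList.map fun j => (π p j, j)
  have hcard : Fintype.card (P × P) = (n.choose k) ^ 2 := by
    rw [Fintype.card_prod, Fintype.card_coe, hP, Finset.card_powersetCard, Finset.card_univ,
      Fintype.card_fin, sq]
  have hword : ∀ p p' : P × P, ((α p ++ β p').map fun v => Finsupp.single v (1 : ℕ)).sum =
      ∑ j ∈ (p.2 : Finset (Fin n)), Finsupp.single (π p j, j) 1 +
        ∑ j ∈ (p'.2 : Finset (Fin n))ᶜ, Finsupp.single (π p' j, j) 1 := by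
    intro p p'
    simp only [α, β, List.map_append, List.sum_append, List.map_map, Function.comp_def,
      Finset.sum_map_toList]
  -- the matrix is the identity
  have hM : (Matrix.of fun p p' => coeff 0 ((α p ++ β p').foldr (fun v g => pderiv v g)
      (perPoly (Fin n) ℂ))) = 1 := by
    ext p p'
    rw [Matrix.of_apply, Matrix.one_apply]
    by_cases hpp : p = p'
    · -- diagonal: the word lists the monomial of `π p` once
      subst hpp
      rw [if_pos rfl]
      have hnd : (α p ++ β p).Nodup := by
        have hlist : α p ++ β p = ((p.2 : Finset (Fin n)).toList ++
            ((p.2 : Finset (Fin n))ᶜ).toList).map (fun j => (π p j, j)) := by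
          simp only [α, β, List.map_append]
        rw [hlist]
        refine List.Nodup.map (fun j j' h => (Prod.ext_iff.1 h).2) ?_
        refine List.nodup_append'.2 ⟨Finset.nodup_toList _, Finset.nodup_toList _, ?_⟩
        intro j h1 h2
        rw [Finset.mem_toList] at h1 h2
        exact (Finset.mem_compl.1 h2) h1
      rw [coeff_iterD_of_nodup _ hnd 0 (fun _ _ => rfl), zero_add, hword,
        Finset.sum_add_sum_compl, coeff_perPoly_rho]
    · -- off the diagonal: the exponent is not a permutation monomial
      rw [if_neg hpp]
      obtain ⟨K, hK⟩ := exists_coeff_iterD (R := ℂ) (α p ++ β p') 0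
      rw [hK, zero_add, hword, coeff_perPoly_eq_zero, mul_zero]
      intro τ hτ
      by_cases hT : (p.2 : Finset (Fin n)) = p'.2
      · -- same columns, different rows: some row index is hit twice
        have hS : (p.1 : Finset (Fin n)) ≠ p'.1 := by
          intro hS
          exact hpp (Prod.ext (Subtype.ext hS) (Subtype.ext hT))
        obtain ⟨a₀, ha₀, ha₀'⟩ : ∃ a₀ ∈ (p.1 : Finset (Fin n)), a₀ ∉ (p'.1 : Finset (Fin n)) := by
          by_contra hcon
          push Not at hcon
          exact hS (Finset.eq_of_subset_of_card_le hcon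
            (by rw [hmemP p.1.2, hmemP p'.1.2]))
        have h1 : (π p).symm a₀ ∈ (p.2 : Finset (Fin n)) := by
          rw [← hπ p, Equiv.apply_symm_apply]; exact ha₀
        have h2 : (π p').symm a₀ ∈ (p'.2 : Finset (Fin n))ᶜ := by
          rw [Finset.mem_compl, ← hπ p', Equiv.apply_symm_apply]; exact ha₀'
        have key := congrArg (fun d : Fin n × Fin n →₀ ℕ => Finsupp.mapDomain Prod.fst d a₀) hτ
        rw [mapDomain_fst_rho, Finsupp.mapDomain_add, Finsupp.add_apply] at key
        have l1 := one_le_mapDomain_fst_sum_single (π p) (p.2 : Finset (Fin n)) a₀ h1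
        have l2 := one_le_mapDomain_fst_sum_single (π p') ((p'.2 : Finset (Fin n))ᶜ) a₀ h2
        omega
      · -- different columns: some column index is hit twice
        obtain ⟨j₀, hj₀, hj₀'⟩ : ∃ j₀ ∈ (p.2 : Finset (Fin n)), j₀ ∉ (p'.2 : Finset (Fin n)) := by
          by_contra hcon
          push Not at hcon
          exact hT (Finset.eq_of_subset_of_card_le hcon
            (by rw [hmemP p.2.2, hmemP p'.2.2]))
        have key := congrArg (fun d : Fin n × Fin n →₀ ℕ => Finsupp.mapDomain Prod.snd d j₀) hτ
        rw [mapDomain_snd_rho, Finsupp.mapDomain_add, Finsupp.add_apply, mapDomain_snd_sum_single,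
          mapDomain_snd_sum_single, if_pos hj₀, if_pos (Finset.mem_compl.2 hj₀')] at key
        omega
  have hαlen : ∀ p, (α p).length = k := by
    intro p
    simp only [α, List.length_map, Finset.length_toList, hmemP p.2.2]
  have hβlen : ∀ p, (β p).length = n - k := by
    intro p
    simp only [β, List.length_map, Finset.length_toList, Finset.card_compl, Fintype.card_fin,
      hmemP p.2.2]
  -- transport the index set to `Fin N`
  let e := Fintype.equivFin (P × P)
  refine ⟨Fintype.card (P × P), α ∘ e.symm, β ∘ e.symm, hcard, ?_, ?_⟩
  · intro i j
    rw [Function.comp_apply, Function.comp_apply, hαlen, hβlen]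
    omega
  · have hsub : (Matrix.of fun i j => coeff 0 (((α ∘ e.symm) i ++ (β ∘ e.symm) j).foldr
        (fun v g => pderiv v g) (perPoly (Fin n) ℂ))) =
        (Matrix.of fun p p' => coeff 0 ((α p ++ β p').foldr (fun v g => pderiv v g)
          (perPoly (Fin n) ℂ))).submatrix e.symm e.symm := rfl
    rw [hsub, Matrix.det_submatrix_equiv_self, hM, Matrix.det_one]
    exact one_ne_zero

end Summit.ValiantsHypothesis.ValiantsHypothesis.Theorems.ChowBorderDepth3LocalFanInTwo

end
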